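import Literature.IUT.HodgeTheaters.Cor53iNeukirchUchidaDischarged
import HarnessLib

/-!
# Layer-5 certificate v0.29 — BLOCK M over BUILT Literature modules only: [IUTchI] Cor 5.3 (i) at `⊛` and at `⊚` with the FACT
# {`NeukirchUchida F`} DISCHARGED IN KERNEL — three FACT-FREE displays (C-53i⊛-bij′), (C-53i⊚-bij@open-emb″), (C-53i⊚-desc-law)
# (abc-iut-L5-lead gen 11 RULINGS #243 «V29 BlocksM candidate»; drafted by abc-iut-L5-t11 gen 23 for the CERT-L5 R73 holder;
# plan/L5/LAYER5-CERT-SPEC.md §7)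

PROOF-ONLY (no `def`, no `instance`, no `axiom`, no `sorry`, no `notation`); NO `Conditional` import (architecture-neutral).  Each
theorem is a landed Literature theorem VERBATIM (section variables spelled in), proof BY NAME — one call, from abc-iut-L5-t11's row
«NU-DISCHARGE@COR53I»: ★ `Cor53iNeukirchUchidaDischarged` (the apex headlines of the Cor 5.3 (i) slot re-issued with the binder
`(hNU : NeukirchUchida F)` DELETED, the Neukirch–Uchida theorem being the tree's THEOREM ★ p458975
`Literature.AnabelianGeometry.AbsoluteAnabelian.neukirchUchida_holds`, abc-iut-L4-d2, axioms `propext · Classical.choice · Quot.sound`):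
* (C-53i⊛-bij′) `layer5_disch_cor53i_v29_arith_descendBijective (F)` := `Cor53.arith_descendBijective`: [IUTchI] Cor 5.3 (i) AS PRINTED
  («the natural map `Isom(¹ℱ^⊛, ²ℱ^⊛) → Isom(Base(¹ℱ^⊛), Base(²ℱ^⊛))` ... is bijective», p.144 ll.7–11 — print's TWO-OBJECT `Isom` form;
  displayed here at the self-instance ¹ℱ = ²ℱ (Aut form)) at the genuine arithmetic model `ℱ^⊛(†𝒟^⊚) → ℬ(G_F)⁰`, for EVERY number field `F` —
  DISPLAYED binders ∅ beyond `F`: FACT ∅ · LAW ∅ · SIDE ∅ (supersedes (C-53i⊛) of BLOCK G in reading: its {hNU} is discharged);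
* (C-53i⊚-bij@open-emb″) `layer5_disch_cor53i_v29_fcirc_descendBijective_openEmbedding (F) (H) (ι) (hc) (ho) (hinj) (𝓕)` :=
  `Cor53.fcirc_descendBijective_of_openEmbedding`: Cor 5.3 (i) «resp. `⊚`» AS PRINTED at the push carrier of EVERY open embedding
  `ι : H ↪ G_F`, EVERY record — DISPLAYED binders = carrier data {`hc`, `ho`, `hinj`} ONLY: FACT ∅ · LAW ∅ · SIDE ∅ (supersedes BLOCK L's
  (C-53i⊚-bij@open-emb′) in reading: its {hNU} is discharged);
* (C-53i⊚-desc-law) `layer5_disch_cor53i_v29_forall_openEmbedding_hdesc_iff_normal (F)` := `Cor53.forall_openEmbedding_hdesc_iff_normal`: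
  at the `G_F` stand-in, the descent law `hdesc⊚` at EVERY open-embedding carrier `⟺ F/ℚ` normal — an UNCONDITIONAL `iff` (the SIDE
  {`Normal ℚ F`} of BLOCK K is EXACTLY the law of the DESCENT route; the LIFT route of BLOCK L / this block's second display needs nothing).
CENSUS delta for §7 (the lead's booking): display +3 conjuncts with binder sets ∅ / data {hc, ho, hinj} / ∅; FACT column −{`NeukirchUchida F`}
(discharged in kernel by ★ p458975; RULINGS #243 (1) correction of record); SIDE-EXTRA register unchanged in content ({`Normal ℚ F`} =
the descent-route law, now displayed as an `iff`); tokens none (Cor5.3(i) already discharged-as-typed).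
S. Mochizuki, *Inter-universal Teichmüller theory I* [cite: Mochizuki2012] (D-0012 claim key; series status DISPUTED): Cor 5.3 (i) p. 144;
Ex 5.1 (i)/(iii)/(v) pp. 123–129.  [NSW] Thm (12.2.1) [cite: NeukirchSchmidtWingberg2008, Thm (12.2.1)].  HONEST FRAMING: a CERT conjunct
DISPLAYS its binders; `NeukirchUchida F` is OUR typed Prop of [NSW] (12.2.1), DISCHARGED in the tree by abc-iut-L4 (its print-faithfulness
is p437013's statement audit); OUR stand-in carriers and OUR lift / descent routes; nothing here asserts that abc is proved or refuted or
takes a side on [IUTchIII] Cor. 3.12; typed ≠ inhabited ≠ proved-in-print; indexed ≠ endorsed.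
(Doc-only amendment, plan/L5/ERRATA-L5.tsv I-117 (a): the Cor 5.3 (i) guillemets in this header and in the docstring of
`layer5_disch_cor53i_v29_arith_descendBijective` now quote print's two-object `Isom` form and name OUR display as its self-instance;
no statement or proof byte changed.)
-/

namespace Summit.ABC.IUTFork.Conditional

open CategoryTheory Opposite Function Literature.IUT.HodgeTheaters
open Literature.AnabelianGeometry.SemiGraphs Literature.AlgebraicGeometry.Frobenioids
open Literature.AlgebraicGeometry.Frobenioids.QuasiTemperoid Literature.NumberTheory.GaloisRepresentations

noncomputable section BlocksMV29

/-- **(C-53i⊛-bij′) [IUTchI] Cor 5.3 (i) AS PRINTED («the natural map `Isom(¹ℱ^⊛, ²ℱ^⊛) → Isom(Base(¹ℱ^⊛), Base(²ℱ^⊛))` ... is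
bijective», p.144 ll.7–11 — print's TWO-OBJECT `Isom` form; displayed here at the self-instance ¹ℱ = ²ℱ (Aut form)) at the genuine
arithmetic model `ℱ^⊛(†𝒟^⊚) → ℬ(G_F)⁰` — FACT ∅ · LAW ∅ · SIDE ∅** := abc-iut-L5-t11's ★ `Cor53.arith_descendBijective` (FACT {NU}
discharged by ★ `neukirchUchida_holds`, abc-iut-L4-d2 p458975).  OUR model and stand-in carrier; not an abc claim.
[cite: Mochizuki2012, IUTchI Cor 5.3 (i) p.144] [claim: Mochizuki2012, status: disputed] -/
theorem layer5_disch_cor53i_v29_arith_descendBijective (F : Type) [Field F] [NumberField F] :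
    CatIsomorphism.DescendBijective (GlobalDivisorData.arith F).modelBase (GlobalDivisorData.arith F).modelBase
      (GlobalDivisorData.hasUnder_modelBase_arith F F) (GlobalDivisorData.underUnique_modelBase_arith F F) :=
  Cor53.arith_descendBijective F

/-- **(C-53i⊚-bij@open-emb″) [IUTchI] Cor 5.3 (i) «resp. `⊚`» AS PRINTED («bijective») at the push carrier of EVERY open embedding
`ι : H ↪ G_F`, for EVERY record — displayed binders = carrier data {`hc`, `ho`, `hinj`} ONLY: FACT ∅ · LAW ∅ · SIDE ∅** := abc-iut-L5-t11's ★
`Cor53.fcirc_descendBijective_of_openEmbedding` (FACT {NU} discharged by ★ `neukirchUchida_holds`, abc-iut-L4-d2 p458975).  OUR stand-in carrier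
and OUR lift route; not an abc claim. [cite: Mochizuki2012, IUTchI Cor 5.3 (i) p.144] [claim: Mochizuki2012, status: disputed] -/
theorem layer5_disch_cor53i_v29_fcirc_descendBijective_openEmbedding (F : Type) [Field F] [NumberField F]
    (H : ProfiniteGrp.{0}) (ι : H →* GalFbar F) (hc : Continuous ι) (ho : IsOpenMap ι) (hinj : Injective ι)
    (𝓕 : GlobalFrobenioid (GlobalDivisorData.arith F) (BaseCat H)
      (baseToCoset H ⋙ CosetCat.push ι ho ⋙ cosetToBase (absGalGrp F))) :
    CatIsomorphism.DescendBijective 𝓕.fcircBase 𝓕.fcircBase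
      (GlobalFrobenioid.hasUnder_and_underUnique_fcircBase_arith_baseCat 𝓕 𝓕
        (isSlimGroup_of_injective_of_isOpenMap ι ho hinj (isSlimGroup_absGalGrp F))
        (isSlimGroup_of_injective_of_isOpenMap ι ho hinj (isSlimGroup_absGalGrp F))).1
      (GlobalFrobenioid.hasUnder_and_underUnique_fcircBase_arith_baseCat 𝓕 𝓕
        (isSlimGroup_of_injective_of_isOpenMap ι ho hinj (isSlimGroup_absGalGrp F))
        (isSlimGroup_of_injective_of_isOpenMap ι ho hinj (isSlimGroup_absGalGrp F))).2 :=
  Cor53.fcirc_descendBijective_of_openEmbedding F H ι hc ho hinj 𝓕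

/-- **(C-53i⊚-desc-law) at the `G_F` stand-in: `hdesc⊚` at EVERY open-embedding carrier (every record) `⟺ F/ℚ` normal — UNCONDITIONAL
`iff`** := abc-iut-L5-t4's law made FACT-free by abc-iut-L5-t11's ★ `Cor53.forall_openEmbedding_hdesc_iff_normal` (★ `neukirchUchida_holds`,
abc-iut-L4-d2 p458975).  OUR stand-in carriers and OUR descent route; not an abc claim.
[cite: Mochizuki2012, IUTchI Cor 5.3 (i) p.144] [claim: Mochizuki2012, status: disputed] -/
theorem layer5_disch_cor53i_v29_forall_openEmbedding_hdesc_iff_normal (F : Type) [Field F] [NumberField F] :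
    (∀ (H : ProfiniteGrp.{0}) (ι : H →* GalFbar F) (_ : Continuous ι) (ho : IsOpenMap ι) (_ : Injective ι)
      (𝓕 : GlobalFrobenioid (GlobalDivisorData.arith F) (BaseCat H)
        (baseToCoset H ⋙ CosetCat.push ι ho ⋙ cosetToBase (absGalGrp F))),
      ∀ Θ : BaseCat H ≌ BaseCat H, ∃ ΘB : 𝓕.Base ≌ 𝓕.Base, Nonempty (Θ.functor ⋙ 𝓕.baseMor ≅ 𝓕.baseMor ⋙ ΘB.functor)) ↔
      Normal ℚ F :=
  Cor53.forall_openEmbedding_hdesc_iff_normal F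

end BlocksMV29

end Summit.ABC.IUTFork.Conditional

/-! ### Build-lane export guard (ops-buildfix bf1-g30, 2026-08-28; G11b-3 recipe v2 as in `GelbartRogawski1991/UnitaryDualPairSeesawCharacter`):
the theorems of this file carry very large dependent telescopes; at `.olean` export Lean 4.32's library-suggestion indexers fold over
every local theorem statement and do not finish within the build lane's one-hour clock (measured on a farm node: `lean -o` > 1 500 s, plain
elaboration ≈ 20 s). ONE file-final `local` `[implicit_reducible]` keeps them out of that premise index (inert for Meta and the kernel on
theorems; no definition is tagged; statements and proofs unchanged). -/
set_option allowUnsafeReducibility true in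
attribute [local implicit_reducible]
  _root_.Summit.ABC.IUTFork.Conditional.layer5_disch_cor53i_v29_arith_descendBijective
  _root_.Summit.ABC.IUTFork.Conditional.layer5_disch_cor53i_v29_fcirc_descendBijective_openEmbedding
  _root_.Summit.ABC.IUTFork.Conditional.layer5_disch_cor53i_v29_forall_openEmbedding_hdesc_iff_normal
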